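import Summits.AtomisticToContinuum.Crystallization.Theses.FreeSplittingCertificates
import Literature.Geometry.DiscreteGeometry.LayerStackings
import Literature.Geometry.DiscreteGeometry.LayerShellPatterns
import Summits.AtomisticToContinuum.Crystallization.Theorems.ThreeConeCertificateSlackRigidityWitness
import Summits.AtomisticToContinuum.Crystallization.Theorems.ShellsToBarlowChart.Negative.Calibration
import HarnessLib

/-!
# Route FreeSplittingCertificates — item 12569 `ExactHcpShellsRigidity` (support)

Item `stmt-AtomisticToContinuum-12569` (the `η = 0`, `L = ∞`, `t = 0` case of `ShellRigidityHcp`):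
a nonempty `V ⊂ ℝ³` in which the punctured `5a/4`-neighbourhood of every point, recentred, is
EXACTLY congruent (`ShellCloseTo 0`) to `a · hcpKissingPattern` is an isometric image of
`hcpStacking a (a√(2/3))`.

PROOF (Hales, *Dense Sphere Packings* §1.3, as discharged in the tree, plus bookkeeping).
* `ShellCloseTo 0 T P` means `T = A(P)` for a linear isometry `A` (a `0`-matching is an equality
  of finite sets, `mem_iff_of_etaMatched_zero`), so the recentred punctured `5a/4`-neighbourhood of
  `v ∈ V` is `{a · A p : p ∈ hcpKissingPattern}` (`exists_shell_iff`): twelve points at distance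
  exactly `a`.  Hence distinct points of `V` are `≥ a` apart (`le_dist_of_shells`).
* Rescale: `W = {y | (a/2) y ∈ V}` is a packing of unit balls whose every kissing shell is the
  HCP pattern (`isUnitBallPacking_rescaled`, `isArrangedIn_kissingShell_rescaled`).
* DSP §1.3 in the tree: a frame `x ↦ p₀ + L x` with a full first layer
  (`exists_frame_layer_subset`) and `{x | p₀ + L x ∈ W} = barlowStacking 2 𝗁 s` for a Hägg
  sequence `s` (`eq_barlowStacking_of_layer`).
* The shell of `barlowPos (m+1) 0 0` is `layerShell (s (m+1)) (−s m)`
  (`kissingShell_barlowStacking_eq_layerShell`); it is an HCP pattern, hence not centrally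
  symmetric (`not_centrallySymmetric_of_hcp_range`), hence of type `(σ, σ)`
  (`layerShell_types_eq_of_not_symmetric`): `s (m+1) = −s m` for all `m`, so `s = ±alternatingHagg`
  and the stacking is `hcpStacking 2 𝗁` up to the identity or the half-turn
  (`eq_mul_alternatingHagg`, `barlowStacking_neg_alternating`).
* Undo the frame and the scaling: `V = g '' hcpStacking a (a√(2/3))` with
  `g z = (a/2) p₀ + L (B z)` and `(a/2) · barlowPos 2 𝗁 = barlowPos a (a√(2/3))`.
No new definitions; all auxiliary lemmas `[folklore]`.
-/

noncomputable section

namespace Summit.AtomisticToContinuum.Crystallization.Theorems.ExactHcpShells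

open Literature.Geometry.DiscreteGeometry Literature.MathematicalPhysics.StatisticalMechanics
open Summit.AtomisticToContinuum.Crystallization.Theorems.SlackRigidityNegative (E3)

/-! ### Exact shells: `ShellCloseTo 0` unpacked -/

/-- A `0`-matching of finite point sets is an equality of their underlying sets. [folklore] -/
theorem mem_iff_of_etaMatched_zero {T P : Finset E3} (h : EtaMatched 0 T P) (x : E3) :
    x ∈ T ↔ x ∈ P := by
  obtain ⟨e, he⟩ := h
  have key : ∀ t : ↥T, (t : E3) = (e t : E3) := fun t => dist_le_zero.1 (he t)
  constructor
  · intro hx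
    have h1 := key ⟨x, hx⟩
    have h2 : ((e ⟨x, hx⟩ : ↥P) : E3) ∈ P := (e ⟨x, hx⟩).2
    rw [← h1] at h2
    exact h2
  · intro hx
    have h1 := key (e.symm ⟨x, hx⟩)
    rw [Equiv.apply_symm_apply] at h1
    have h2 : ((e.symm ⟨x, hx⟩ : ↥T) : E3) ∈ T := (e.symm ⟨x, hx⟩).2
    rwa [h1] at h2

/-- **The exact-shell hypothesis, unpacked.** If the recentred punctured `5a/4`-neighbourhood of
`v` in `V` is (as a finite set) `0`-close to `a · hcpKissingPattern`, then it is literally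
`{a · A p : p ∈ hcpKissingPattern}` for a linear isometry `A`. [folklore] -/
theorem exists_shell_iff {a : ℝ} {V : Set E3} {v : E3} {T : Finset E3}
    (hT : (↑T : Set E3) = (fun u => u - v) '' {u ∈ V | u ≠ v ∧ dist u v ≤ 5 * a / 4})
    (hc : ShellCloseTo 0 T (hcpKissingPattern.image fun u => a • u)) :
    ∃ A : E3 →ₗᵢ[ℝ] E3, ∀ x : E3,
      (v + x ∈ V ∧ x ≠ 0 ∧ ‖x‖ ≤ 5 * a / 4) ↔ ∃ p ∈ hcpKissingPattern, x = a • A p := by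
  obtain ⟨A, hA⟩ := hc
  refine ⟨A, fun x => ?_⟩
  have h1 : x ∈ T ↔ x ∈ (hcpKissingPattern.image fun u => a • u).image A :=
    mem_iff_of_etaMatched_zero hA x
  have h2 : x ∈ (↑T : Set E3) ↔ v + x ∈ V ∧ x ≠ 0 ∧ ‖x‖ ≤ 5 * a / 4 := by
    rw [hT]
    constructor
    · rintro ⟨u, ⟨huV, huv, hd⟩, rfl⟩
      refine ⟨by simpa using huV, ?_, ?_⟩
      · show u - v ≠ 0
        exact sub_ne_zero.2 huv
      · show ‖u - v‖ ≤ 5 * a / 4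
        rwa [← dist_eq_norm]
    · rintro ⟨hxV, hx0, hxn⟩
      refine ⟨v + x, ⟨hxV, ?_, ?_⟩, ?_⟩
      · intro h
        apply hx0
        have h' : v + x - v = v - v := by rw [h]
        simpa using h'
      · show dist (v + x) v ≤ 5 * a / 4
        rwa [dist_eq_norm, add_sub_cancel_left]
      · show v + x - v = x
        exact add_sub_cancel_left v x
  rw [Finset.mem_coe] at h2
  rw [← h2, h1]
  simp only [Finset.mem_image]
  constructor
  · rintro ⟨_, ⟨p, hp, rfl⟩, rfl⟩
    exact ⟨p, hp, by rw [map_smul]⟩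
  · rintro ⟨p, hp, rfl⟩
    exact ⟨a • p, ⟨p, hp, rfl⟩, by rw [map_smul]⟩

/-- **Exact shells force separation `a`**: two distinct points of `V` closer than `a` would put
one in the other's shell, all of whose points are at distance exactly `a`. [folklore] -/
theorem le_dist_of_shells {a : ℝ} (ha : 0 < a) {V : Set E3}
    (hV : ∀ v ∈ V, ∃ A : E3 →ₗᵢ[ℝ] E3, ∀ x : E3,
      (v + x ∈ V ∧ x ≠ 0 ∧ ‖x‖ ≤ 5 * a / 4) ↔ ∃ p ∈ hcpKissingPattern, x = a • A p)
    {u w : E3} (hu : u ∈ V) (hw : w ∈ V) (huw : u ≠ w) : a ≤ dist u w := by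
  by_contra hlt
  have hlt' := not_le.1 hlt
  obtain ⟨A, hA⟩ := hV w hw
  have hx : w + (u - w) ∈ V ∧ u - w ≠ 0 ∧ ‖u - w‖ ≤ 5 * a / 4 := by
    refine ⟨by simpa using hu, sub_ne_zero.2 huw, ?_⟩
    rw [← dist_eq_norm]
    linarith
  obtain ⟨p, hp, hpeq⟩ := (hA _).1 hx
  have : dist u w = a := by
    rw [dist_eq_norm, hpeq, norm_smul, A.norm_map, norm_eq_one_of_mem_hcpKissingPattern hp, mul_one,
      Real.norm_of_nonneg ha.le]
  linarith

/-! ### The rescaled packing `W = {y | (a/2) y ∈ V}` -/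

/-- The rescaled set is a packing of unit balls (distinct points `≥ 2` apart). [folklore] -/
theorem isUnitBallPacking_rescaled {a : ℝ} (ha : 0 < a) {V : Set E3}
    (hsep : ∀ u ∈ V, ∀ w ∈ V, u ≠ w → a ≤ dist u w) :
    IsUnitBallPacking {y : E3 | (a / 2) • y ∈ V} := by
  intro y hy y' hy' hlt
  have hd : (0 : ℝ) < a / 2 := by positivity
  by_contra hne
  have hne' : (a / 2) • y ≠ (a / 2) • y' := fun h => hne (smul_right_injective E3 hd.ne' h)
  have h := hsep _ hy _ hy' hne'
  rw [dist_smul₀, Real.norm_of_nonneg hd.le] at h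
  nlinarith

/-- **Every kissing shell of the rescaled set is the HCP pattern** (with the same linear
isometry as the exact shell of the corresponding point of `V`). [folklore] -/
theorem isArrangedIn_kissingShell_rescaled {a : ℝ} (ha : 0 < a) {V : Set E3}
    (hV : ∀ v ∈ V, ∃ A : E3 →ₗᵢ[ℝ] E3, ∀ x : E3,
      (v + x ∈ V ∧ x ≠ 0 ∧ ‖x‖ ≤ 5 * a / 4) ↔ ∃ p ∈ hcpKissingPattern, x = a • A p)
    {u : E3} (hu : (a / 2) • u ∈ V) :
    IsArrangedIn (kissingShell {y : E3 | (a / 2) • y ∈ V} u) hcpKissingPattern := by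
  obtain ⟨A, hA⟩ := hV _ hu
  have hd : (0 : ℝ) < a / 2 := by positivity
  refine ⟨A, Set.ext fun x => ?_⟩
  rw [mem_kissingShell_iff, Set.mem_setOf_eq, smul_add]
  constructor
  · rintro ⟨hxV, hxn⟩
    have hn : ‖(a / 2) • x‖ = a := by
      rw [norm_smul, Real.norm_of_nonneg hd.le, hxn]; ring
    have hx : (a / 2) • u + (a / 2) • x ∈ V ∧ (a / 2) • x ≠ 0 ∧ ‖(a / 2) • x‖ ≤ 5 * a / 4 := by
      refine ⟨hxV, ?_, by rw [hn]; linarith⟩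
      rw [← norm_ne_zero_iff, hn]
      exact ha.ne'
    obtain ⟨p, hp, hpeq⟩ := (hA _).1 hx
    refine ⟨p, hp, ?_⟩
    apply smul_right_injective E3 hd.ne'
    show (a / 2) • ((2 : ℝ) • A p) = (a / 2) • x
    rw [hpeq, smul_smul]
    congr 1
    ring
  · rintro ⟨p, hp, rfl⟩
    have h2 : (a / 2) • ((2 : ℝ) • A p) = a • A p := by
      rw [smul_smul]
      congr 1
      ring
    refine ⟨?_, ?_⟩
    · show (a / 2) • u + (a / 2) • ((2 : ℝ) • A p) ∈ V
      rw [h2]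
      exact ((hA _).2 ⟨p, hp, rfl⟩).1
    · show ‖(2 : ℝ) • A p‖ = 2
      rw [norm_smul, A.norm_map, norm_eq_one_of_mem_hcpKissingPattern hp, mul_one,
        Real.norm_of_nonneg zero_le_two]

/-! ### All shells HCP ⇒ the Hägg word alternates ⇒ the stacking is HCP -/

/-- "All shells HCP" is preserved by moving the packing by `x ↦ p₀ + L x`. [folklore] -/
theorem allHcp_preimage (p₀ : E3) (L : E3 ≃ₗᵢ[ℝ] E3) {V : Set E3}
    (h : ∀ u ∈ V, IsArrangedIn (kissingShell V u) hcpKissingPattern) :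
    ∀ u ∈ {x | p₀ + L x ∈ V}, IsArrangedIn (kissingShell {x | p₀ + L x ∈ V} u) hcpKissingPattern := by
  intro u hu
  rw [kissingShell_preimage]
  exact (h _ hu).preimage L

/-- **A layer shell arranged in the HCP pattern is of HCP type `(σ, σ)`**: the HCP pattern is not
centrally symmetric, the FCC-type shells `layerShell σ (−σ)` are. [folklore] -/
theorem types_eq_of_isArrangedIn_layerShell_hcp {σ σ' : ℝ} (hσ : σ = 1 ∨ σ = -1)
    (hσ' : σ' = 1 ∨ σ' = -1) (h : IsArrangedIn (layerShell σ σ') hcpKissingPattern) : σ' = σ := by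
  obtain ⟨A, hA⟩ := isArrangedIn_hcp_iff_range.1 h
  exact layerShell_types_eq_of_not_symmetric hσ hσ' (not_centrallySymmetric_of_hcp_range hA)

/-- **All shells HCP ⇒ the Hägg sequence alternates.** In the close-packed stacking of `s` the
shell of `barlowPos (m+1) 0 0` is `layerShell (s (m+1)) (−s m)`; if it is an HCP pattern then
`−s m = s (m+1)`. [cite: HalesDSP2012, §1.3 ("The HCP packing is …ABABAB…")] -/
theorem succ_eq_neg_of_allHcp {s : ℤ → ℤ} (hs : IsHaggSeq s)
    (h : ∀ u ∈ barlowStacking 2 layerSpacing s,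
      IsArrangedIn (kissingShell (barlowStacking 2 layerSpacing s) u) hcpKissingPattern)
    (m : ℤ) : s (m + 1) = -s m := by
  have hk := h _ (barlowPos_mem (m + 1) 0 0)
  rw [kissingShell_barlowStacking_eq_layerShell hs (m + 1) 0 0, add_sub_cancel_right] at hk
  have hσ : ((s (m + 1) : ℤ) : ℝ) = 1 ∨ ((s (m + 1) : ℤ) : ℝ) = -1 := by
    rcases hs (m + 1) with h1 | h1 <;> simp [h1]
  have hσ' : -((s m : ℤ) : ℝ) = 1 ∨ -((s m : ℤ) : ℝ) = -1 := by
    rcases hs m with h1 | h1 <;> simp [h1]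
  have heq := types_eq_of_isArrangedIn_layerShell_hcp hσ hσ' hk
  have : ((s (m + 1) : ℤ) : ℝ) = ((-s m : ℤ) : ℝ) := by push_cast; linarith
  exact_mod_cast this

/-- **An alternating Hägg word codes the HCP stacking** up to a linear isometry (the identity
for `s = alternatingHagg`, the half-turn about `e₃` for `s = −alternatingHagg`). [folklore] -/
theorem exists_eq_image_hcpStacking {s : ℤ → ℤ} (hs : IsHaggSeq s)
    (halt : ∀ m, s (m + 1) = -s m) (a h : ℝ) :
    ∃ B : E3 ≃ₗᵢ[ℝ] E3, barlowStacking a h s = B '' hcpStacking a h := by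
  have hmul : ∀ m, s m = s 0 * alternatingHagg m :=
    CLayerWitnessWitness.eq_mul_alternatingHagg halt
  rcases hs 0 with h0 | h0
  · obtain rfl : s = alternatingHagg := funext fun m => by rw [hmul, h0, one_mul]
    exact ⟨LinearIsometryEquiv.refl ℝ E3, by simp [hcpStacking]⟩
  · obtain rfl : s = fun m => -alternatingHagg m := funext fun m => by rw [hmul, h0]; ring
    refine ⟨halfTurn, ?_⟩
    rw [CLayerWitnessWitness.barlowStacking_neg_alternating]
    rfl

/-! ### Scaling the stacking -/

/-- Scaling a Barlow stacking scales both spacings (set form of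
`ShellsToBarlowChartNegative.smul_barlowPos`). [folklore] -/
theorem smul_image_barlowStacking (c a h : ℝ) (s : ℤ → ℤ) :
    (fun x : E3 => c • x) '' barlowStacking a h s = barlowStacking (c * a) (c * h) s := by
  ext x
  constructor
  · rintro ⟨_, ⟨k, i, j, rfl⟩, rfl⟩
    exact ⟨k, i, j, ShellsToBarlowChartNegative.smul_barlowPos c a h s k i j⟩
  · rintro ⟨k, i, j, rfl⟩
    exact ⟨_, barlowPos_mem k i j, ShellsToBarlowChartNegative.smul_barlowPos c a h s k i j⟩

/-! ### The item -/

/-- **Item 12569 `ExactHcpShellsRigidity`** (route `FreeSplittingCertificates`, support; the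
`η = 0, L = ∞, t = 0` case of `ShellRigidityHcp`): a nonempty `V ⊂ ℝ³` in which every point's
punctured `5a/4`-neighbourhood, recentred, is exactly congruent to `a · hcpKissingPattern` is an
isometric image of `hcpStacking a (a√(2/3))`.  Exact shells give `a`-separation; rescaled by
`2/a`, `V` is a unit-ball packing all of whose tangent arrangements are HCP patterns; Hales's
*Dense Sphere Packings* §1.3 (`exists_frame_layer_subset`, `eq_barlowStacking_of_layer`) makes it
a Barlow stacking in a frame, and HCP shells everywhere force the alternating Hägg word.
[cite: HalesDSP2012, §1.3 (pp. 12–13)] -/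
theorem _root_.Summit.AtomisticToContinuum.Crystallization.Theorems.exactHcpShellsRigidity_proof :
    Summit.AtomisticToContinuum.Crystallization.Theses.FreeSplittingCertificates.ExactHcpShellsRigidity := by
  unfold Summit.AtomisticToContinuum.Crystallization.Theses.FreeSplittingCertificates.ExactHcpShellsRigidity
  intro a ha V hne hshell
  -- the exact shells, unpacked
  have hV : ∀ v ∈ V, ∃ A : E3 →ₗᵢ[ℝ] E3, ∀ x : E3,
      (v + x ∈ V ∧ x ≠ 0 ∧ ‖x‖ ≤ 5 * a / 4) ↔ ∃ p ∈ hcpKissingPattern, x = a • A p := by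
    intro v hv
    obtain ⟨T, hT, hc⟩ := hshell v hv
    exact exists_shell_iff hT hc
  have hsep : ∀ u ∈ V, ∀ w ∈ V, u ≠ w → a ≤ dist u w :=
    fun u hu w hw huw => le_dist_of_shells ha hV hu hw huw
  have hd0 : (0 : ℝ) < a / 2 := by positivity
  -- the rescaled packing `W = {y | (a/2) y ∈ V}`
  have hWp : IsUnitBallPacking {y : E3 | (a / 2) • y ∈ V} := isUnitBallPacking_rescaled ha hsep
  have hWne : ({y : E3 | (a / 2) • y ∈ V}).Nonempty := by
    obtain ⟨v, hv⟩ := hne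
    refine ⟨(a / 2)⁻¹ • v, ?_⟩
    show (a / 2) • ((a / 2)⁻¹ • v) ∈ V
    rwa [smul_inv_smul₀ hd0.ne']
  have hWhcp : ∀ u ∈ {y : E3 | (a / 2) • y ∈ V},
      IsArrangedIn (kissingShell {y : E3 | (a / 2) • y ∈ V} u) hcpKissingPattern :=
    fun u hu => isArrangedIn_kissingShell_rescaled ha hV hu
  have hWsh : HasFccOrHcpShells {y : E3 | (a / 2) • y ∈ V} := fun u hu => Or.inr (hWhcp u hu)
  -- Hales, Dense Sphere Packings §1.3: a frame with a full layer, then the whole stacking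
  obtain ⟨p₀, -, L, hlayer⟩ := exists_frame_layer_subset hWp hWne hWsh
  obtain ⟨s, hs, heq⟩ :=
    eq_barlowStacking_of_layer (hWp.preimage p₀ L) (hWsh.preimage p₀ L) hlayer
  -- all shells HCP in the frame, so the word alternates and the stacking is HCP
  have hall := allHcp_preimage p₀ L hWhcp
  rw [heq] at hall
  have halt : ∀ m, s (m + 1) = -s m := succ_eq_neg_of_allHcp hs hall
  obtain ⟨B, hB⟩ := exists_eq_image_hcpStacking hs halt 2 layerSpacing
  have hscale : hcpStacking a (a * Real.sqrt (2 / 3)) =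
      (fun x : E3 => (a / 2) • x) '' hcpStacking 2 layerSpacing := by
    rw [hcpStacking, hcpStacking, smul_image_barlowStacking]
    congr 1
    · ring
    · unfold layerSpacing; ring
  -- undo the frame and the scaling
  refine ⟨(B.trans L).toIsometryEquiv.trans (IsometryEquiv.addLeft ((a / 2) • p₀)), ?_⟩
  ext v
  simp only [Set.mem_image, IsometryEquiv.trans_apply, IsometryEquiv.addLeft_apply,
    LinearIsometryEquiv.coe_toIsometryEquiv, LinearIsometryEquiv.trans_apply]
  constructor
  · intro hv
    have hy : p₀ + L (L.symm ((a / 2)⁻¹ • v - p₀)) ∈ {y : E3 | (a / 2) • y ∈ V} := by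
      show (a / 2) • (p₀ + L (L.symm ((a / 2)⁻¹ • v - p₀))) ∈ V
      rwa [LinearIsometryEquiv.apply_symm_apply, add_sub_cancel, smul_inv_smul₀ hd0.ne']
    have hxW : L.symm ((a / 2)⁻¹ • v - p₀) ∈ {x : E3 | p₀ + L x ∈ {y : E3 | (a / 2) • y ∈ V}} := hy
    rw [heq, hB] at hxW
    obtain ⟨y₂, hy₂, hxy⟩ := hxW
    refine ⟨(a / 2) • y₂, by rw [hscale]; exact ⟨y₂, hy₂, rfl⟩, ?_⟩
    rw [map_smul, map_smul, hxy, LinearIsometryEquiv.apply_symm_apply, smul_sub,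
      smul_inv_smul₀ hd0.ne', add_sub_cancel]
  · rintro ⟨z, hz, rfl⟩
    rw [hscale] at hz
    obtain ⟨y, hy, rfl⟩ := hz
    have hBy : B y ∈ {x : E3 | p₀ + L x ∈ {y : E3 | (a / 2) • y ∈ V}} := by
      rw [heq, hB]; exact ⟨y, hy, rfl⟩
    have : (a / 2) • (p₀ + L (B y)) ∈ V := hBy
    simpa only [smul_add, map_smul] using this

end Summit.AtomisticToContinuum.Crystallization.Theorems.ExactHcpShells

end
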